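import Mathlib.FieldTheory.PurelyInseparable.Tower
import HarnessLib

/-!
# Crux `NoZenoR` (stmt-ResolutionOfSingularities-19943), slot `stub_L1wCoreF`, (B1) split core, assembly seam (A4):
# a separably closed bottom field stays separably closed over any algebraic intermediate field

Route `ResolutionOfSingularities/HomologicalConductor`.  OURS (cell res-hironaka, crux chain W4.4, lead seat
res-L0-w44-lead-1 g8, memo `B1-CENSUS-g8.md` §2 (A4)); nothing here is a statement of the manuscript under review
(Hironaka 2017); AI-written, weaker than expert review.

In STEP 3 (4) of the (B1) split core the surviving old curves `Ē` of the contracted resolution of the chart germ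
`S′ = N_𝔮` must have SPLIT WEIGHT `1` over the residue field `κ(𝔮)` (so that the count-drop brick
`ExcCount.hasSplitExcCurveCountLE_pred_of_mapsTo` applies with `splitWeight π′ Ē ≤ splitWeight π E = 1`).  Upstairs the
old curve `E` has weight `1` over `κ_f` — `κ_f` is separably (algebraically) closed in the function field `κ(E) = κ(Ē)` —
and `κ_f ⊆ κ(𝔮) ⊆ κ(E)` with `κ(𝔮)/κ_f` finite.  Pure field theory then gives weight `1` over `κ(𝔮)`:

* `isPurelyInseparable_of_separableClosure_eq_bot` — tower `K / E / F` with `E / F` algebraic and `F` separably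
  closed in `K` (`separableClosure F K = ⊥`) ⇒ `E / F` is purely inseparable;
* `separableClosure_eq_bot_of_isPurelyInseparable` — tower `K / E / F` with `E / F` purely inseparable and
  `separableClosure F K = ⊥` ⇒ `separableClosure E K = ⊥` (Mathlib's
  `IntermediateField.sepDegree_adjoin_eq_of_isAlgebraic_of_isPurelyInseparable` on `{x}`);
* `separableClosure_eq_bot_of_isAlgebraic` — the two combined: `E / F` algebraic, `separableClosure F K = ⊥` ⇒
  `separableClosure E K = ⊥`; and `finrank_separableClosure_eq_one_of_isAlgebraic` (the `finrank … = 1` form in which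
  `ExcCount.splitWeight` reads it).

References: The Stacks Project, Tag 030K (separable algebraic closure in towers), Tag 09HK [`StacksProject`];
Mathlib `FieldTheory.PurelyInseparable.Tower`.
-/

-- single-problem summit: the doubled namespace component `ResolutionOfSingularities` is forced
set_option linter.dupNamespace false

namespace Summit.ResolutionOfSingularities.ResolutionOfSingularities.Theorems.NoZeno.ExcCount

open IntermediateField Field

variable {F E K : Type*} [Field F] [Field E] [Field K] [Algebra F E] [Algebra E K] [Algebra F K]
  [IsScalarTower F E K]

/-- **An algebraic intermediate extension of a separably closed bottom is purely inseparable**: if `F` is separably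
algebraically closed in `K` (`separableClosure F K = ⊥`) and `E / F` is algebraic (inside the tower `K / E / F`),
then `E / F` is purely inseparable — a separable element of `E` is separable in `K`, hence lies in `F`. [folklore] -/
theorem isPurelyInseparable_of_separableClosure_eq_bot [Algebra.IsAlgebraic F E]
    (h : separableClosure F K = ⊥) : IsPurelyInseparable F E := by
  rw [isPurelyInseparable_iff]
  intro y
  refine ⟨Algebra.IsIntegral.isIntegral y, fun hy => ?_⟩
  -- `algebraMap E K y` is separable over `F`, hence in `F`
  have hyK : IsSeparable F (algebraMap E K y) := by
    have := hy.map (f := IsScalarTower.toAlgHom F E K) (algebraMap E K).injective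
    simpa using this
  have hmem : algebraMap E K y ∈ separableClosure F K := mem_separableClosure_iff.mpr hyK
  rw [h, IntermediateField.mem_bot] at hmem
  obtain ⟨c, hc⟩ := hmem
  refine ⟨c, ?_⟩
  apply (algebraMap E K).injective
  rw [← hc, ← IsScalarTower.algebraMap_apply]

/-- **A separably closed bottom stays separably closed over a purely inseparable intermediate field**: in a tower
`K / E / F` with `E / F` purely inseparable, `separableClosure F K = ⊥ ⇒ separableClosure E K = ⊥`.  (For `x ∈ K`
separable over `E`: `[E(x) : E]_s = [F(x) : F]_s` by Mathlib's tower formula for purely inseparable `E / F`; the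
right side is `1` because `F(x) ⊆ K` has no separable elements outside `F`; the left side is `[E(x) : E]`.)
[folklore] -/
theorem separableClosure_eq_bot_of_isPurelyInseparable [IsPurelyInseparable F E]
    (h : separableClosure F K = ⊥) : separableClosure E K = ⊥ := by
  rw [eq_bot_iff]
  intro x hx
  have hxsep : IsSeparable E x := mem_separableClosure_iff.mp hx
  have hxF : IsIntegral F x := isIntegral_trans x hxsep.isIntegral
  haveI : FiniteDimensional F F⟮x⟯ := adjoin.finiteDimensional hxF
  haveI : FiniteDimensional E E⟮x⟯ := adjoin.finiteDimensional hxsep.isIntegral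
  haveI : IsPurelyInseparable F F⟮x⟯ := isPurelyInseparable_of_separableClosure_eq_bot (E := F⟮x⟯) h
  haveI : Algebra.IsSeparable E E⟮x⟯ := (isSeparable_adjoin_simple_iff_isSeparable (F := E) (E := K)).2 hxsep
  have key := IntermediateField.sepDegree_adjoin_eq_of_isAlgebraic_of_isPurelyInseparable (F := F) E ({x} : Set K)
  rw [IsPurelyInseparable.sepDegree_eq_one F F⟮x⟯] at key
  have h1 : Module.finrank E E⟮x⟯ = 1 := by
    rw [← finSepDegree_eq_finrank_of_isSeparable E E⟮x⟯, finSepDegree_eq, key]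
    simp
  exact finrank_adjoin_simple_eq_one_iff.mp h1

/-- **Combined form**: tower `K / E / F` with `E / F` algebraic and `F` separably closed in `K` ⇒ `E` separably closed
in `K`. [folklore] -/
theorem separableClosure_eq_bot_of_isAlgebraic [Algebra.IsAlgebraic F E]
    (h : separableClosure F K = ⊥) : separableClosure E K = ⊥ :=
  haveI := isPurelyInseparable_of_separableClosure_eq_bot (F := F) (E := E) (K := K) h
  separableClosure_eq_bot_of_isPurelyInseparable (F := F) h

/-- **`finrank` form** (the shape read by `ExcCount.splitWeight = max 1 (finrank κ (separableClosure κ κ(η)))`): tower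
`K / E / F`, `E / F` algebraic, `finrank F (separableClosure F K) = 1` ⇒ `finrank E (separableClosure E K) = 1`.
[folklore] -/
theorem finrank_separableClosure_eq_one_of_isAlgebraic [Algebra.IsAlgebraic F E]
    (h : Module.finrank F (separableClosure F K) = 1) : Module.finrank E (separableClosure E K) = 1 := by
  rw [IntermediateField.finrank_eq_one_iff] at h ⊢
  exact separableClosure_eq_bot_of_isAlgebraic (F := F) h

end Summit.ResolutionOfSingularities.ResolutionOfSingularities.Theorems.NoZeno.ExcCount
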